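import Literature.NumberTheory.Automorphic.RootSl2Triples
import Literature.NumberTheory.Automorphic.RootSystemPositivity
import HarnessLib

/-!
# Root strings in `Lie(G)`: reducedness, `[𝔤_α, 𝔤_β] = 𝔤_{α+β}`, generation by simple root vectors
(trunk T-AUTOMORPHIC, G25 AutomorphicL; characteristic `0`; Humphreys 8.4–8.5, 14.2; Springer 7.4.3–7.4.4, 8.1)

Continuation of `RootSl2Triples.lean` (the `𝔰𝔩₂`-triples `(h_i, e_i, f_i)` of the roots of a root
datum `P` of `(G, T)`, `𝔤_{±α_i} = k e_i, k f_i`, `[h_i, M] = ⟨x, α_i^∨⟩ M` on `𝔤_x`) towards the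
Lie-algebra isomorphism theorem on the DAG of `chevalley_isomorphism` (step 1 of Springer 9.6.2).
With Mathlib's representation theory of `𝔰𝔩₂` (`IsSl2Triple.HasPrimitiveVectorWith`: a primitive
vector of a finite-dimensional module has weight in `ℕ` and `f^j v ≠ 0` for `j ≤` the weight) we
prove, for `G` connected reductive with maximal torus `T` over an algebraically closed field of
characteristic `0`:

* `toEnd_rootF_pow_mem` — `(ad f_i)^j (𝔤_x) ⊆ 𝔤_{x - j α_i}`;
* **`nsmul_root_notMem`** — `m α ∉ R` for `m ≥ 2` (the root datum of `(G, T)` is reduced,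
  Springer 7.4.3–7.4.4, here from the `α`-string through the top multiple of `α`);
* **`lie_rootE_ne_zero_of_add_mem`** — `[e_i, e_j] ≠ 0` whenever `α_i + α_j` is a root
  (Humphreys 8.4 (d): `[𝔤_α, 𝔤_β] = 𝔤_{α+β}`), with the weight-vector forms
  `lie_ne_zero_of_mem_lieWeightSpace_root` and `lie_rootF_ne_zero_of_add_mem`;
* **`rootE_mem_of_forall_simpleRoots`** — a bracket-closed subspace `L ⊆ 𝔤𝔩ₙ` containing `e_i` and
  `f_i` for the simple roots `α_i` (relative to a regular coweight `y`,
  `RootSystemPositivity.lean`) contains `e_i`, `f_i`, `h_i` for *all* roots (Humphreys 14.2,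
  Proposition: `L` is generated by the `𝔤_{±α}`, `α` simple; induction on `⟨α, y⟩` through
  `pos_root_induction`, a positive non-simple root being `β + γ` with `β, γ` positive and
  `[e_β, e_γ] ≠ 0`).

All proofs complete; no named facts.

## Mathlib

`IsSl2Triple`, `IsSl2Triple.HasPrimitiveVectorWith` (`exists_nat`, `pow_toEnd_f_ne_zero_of_eq_nat`,
`lie_e_pow_succ_toEnd_f`), `LieModule.toEnd`, with `LieRing.ofAssociativeRing` as a local instance
(commutator bracket on `Matrix n n k`). Mathlib has no algebraic groups; nothing here duplicates a
Mathlib or Literature declaration (searched `nsmul_root_notMem` — Mathlib's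
`RootPairing.nsmul_notMem_range_root` assumes `IsReduced`, which is what we prove —, `rootE`,
`simpleRoots`).

## References

* [Humphreys1972] J. E. Humphreys, *Introduction to Lie Algebras and Representation Theory*,
  GTM 9, Springer (1972), §7.2, §8.4 (Prop. (c), (d)), §8.5, §14.2.
* [SpringerLAG1998] T. A. Springer, *Linear Algebraic Groups*, 2nd ed. (1998), 7.4.3–7.4.4,
  8.1.1–8.1.3.
-/

noncomputable section

open scoped MatrixGroups IsMulCommutative
open Set

attribute [local instance 100] LieRing.ofAssociativeRing

namespace Literature.NumberTheory.Automorphic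

variable {k : Type*} [Field k] {n : Type*} [Fintype n] [DecidableEq n]
variable {ι X Y : Type*} [AddCommGroup X] [AddCommGroup Y]
variable {G T : Subgroup (GL n k)} [IsMulCommutative ↥T]
variable {P : RootPairing ι ℤ X Y} {eX : Additive ↥(characterLattice T) ≃+ X}
  {eY : Additive ↥(cocharacterLattice T) ≃+ Y}

/-! ### Iterated brackets with `f_i` -/

section Iterate

variable [Infinite k] (h : IsRootDatumOf G T P eX eY) (i : ι)

omit [Infinite k] in
/-- The adjoint action of `f_i` as a Mathlib `toEnd` is the commutator. [folklore] -/
lemma toEnd_rootF_apply (M : Matrix n n k) :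
    LieModule.toEnd k (Matrix n n k) (Matrix n n k) (h.rootF i) M = h.rootF i * M - M * h.rootF i :=
  rfl

/-- **`(ad f_i)^j` lowers weights by `j α_i`**: `(ad f_i)^j (𝔤_x) ⊆ 𝔤_{x - j α_i}`.
[cite: Humphreys1972, 8.4] -/
theorem IsRootDatumOf.toEnd_rootF_pow_mem (x : X) {M : Matrix n n k}
    (hM : M ∈ lieWeightSpace G T (charOfWeight eX x)) (j : ℕ) :
    (LieModule.toEnd k (Matrix n n k) (Matrix n n k) (h.rootF i) ^ j) M ∈
      lieWeightSpace G T (charOfWeight eX (x - (j : ℤ) • P.root i)) := by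
  induction j with
  | zero => simpa using hM
  | succ j ih =>
    rw [pow_succ', Module.End.mul_apply, toEnd_rootF_apply]
    have := lie_mem_lieWeightSpace_charOfWeight eX (h.rootF_mem' i) ih
    have e : -P.root i + (x - (j : ℤ) • P.root i) = x - ((j + 1 : ℕ) : ℤ) • P.root i := by
      push_cast; module
    rwa [e] at this

end Iterate

/-! ### Finite strings of weights -/

section Strings

variable [Finite ι] (P)

/-- For a weight `x` and a root `α_i`, the set of `q ∈ ℕ` with `x + q α_i` a root is finite
(the roots are finite and `q ↦ x + q α_i` is injective). [folklore] -/
theorem finite_setOf_add_nsmul_root_mem (x : X) (i : ι) :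
    {q : ℕ | x + q • P.root i ∈ range P.root}.Finite := by
  have _i1 : Module.IsReflexive ℤ X := .of_isPerfPair P.toLinearMap
  have _i2 : IsAddTorsionFree X := .of_isTorsionFree ℤ X
  have hinj : Function.Injective fun q : ℕ => x + q • P.root i := by
    intro a b hab
    have hab' : (a : ℤ) • P.root i = (b : ℤ) • P.root i := by
      simpa [Nat.cast_smul_eq_nsmul] using hab
    exact_mod_cast smul_left_injective ℤ (P.ne_zero i) hab'
  exact (Set.finite_range P.root).preimage hinj.injOn

end Strings

/-! ### Reducedness and `[𝔤_α, 𝔤_β] = 𝔤_{α + β}` -/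

section Brackets

variable [IsAlgClosed k] [CharZero k] [Finite ι]
variable (hG : IsConnectedReductive G) (hT : IsMaximalTorusIn T G) (h : IsRootDatumOf G T P eX eY)

omit [IsAlgClosed k] [Finite ι] in
/-- A weight vector of a root weight killed by `ad e_i` is a primitive vector for the
`𝔰𝔩₂`-triple of `α_i`, of weight `⟨α_l, α_i^∨⟩`. [cite: Humphreys1972, 7.2] -/
theorem IsRootDatumOf.hasPrimitiveVectorWith_rootE [Infinite k] (i l : ι)
    (h0 : h.rootE i * h.rootE l - h.rootE l * h.rootE i = 0) :
    (h.isSl2Triple_root i).HasPrimitiveVectorWith (h.rootE l) ((P.pairing l i : ℤ) : k) where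
  ne_zero := h.rootE_ne_zero l
  lie_h := by rw [Ring.lie_def]; exact h.lie_rootH_rootE_eq i l
  lie_e := by rw [Ring.lie_def]; exact h0

omit [IsAlgClosed k] [Finite ι] in
include hG hT in
/-- If `x + α_i` is neither `0` nor a root then `[e_i, M] = 0` for `M ∈ 𝔤_x`. [folklore] -/
theorem IsRootDatumOf.lie_rootE_eq_zero_of_not_mem [Infinite k] (i : ι) {x : X} {M : Matrix n n k}
    (hM : M ∈ lieWeightSpace G T (charOfWeight eX x)) (hx0 : P.root i + x ≠ 0)
    (hx : P.root i + x ∉ range P.root) : h.rootE i * M - M * h.rootE i = 0 := by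
  have hmem := lie_mem_lieWeightSpace_charOfWeight eX (h.rootE_mem i) hM
  rw [h.lieWeightSpace_charOfWeight_eq_bot hG hT hx0 hx] at hmem
  simpa using hmem

include hG hT h in
/-- **The root datum of `(G, T)` is reduced** (characteristic `0`): `m α_i` is not a root for
`m ≥ 2` (Springer 7.4.3–7.4.4). Take the largest `q ≥ m` with `q α_i = α_l` a root; then
`[e_i, e_l] = 0`, so `e_l` is primitive of weight `2q` for the `𝔰𝔩₂` of `α_i` and
`(ad f_i)^{q+2} e_l ≠ 0` (as `q + 2 ≤ 2q`); but `(ad f_i)^{q-1} e_l ∈ 𝔤_{α_i} = k e_i` and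
`(ad f_i)^3 e_i = 0`. [cite: SpringerLAG1998, 7.4.3–7.4.4] -/
theorem IsRootDatumOf.nsmul_root_notMem (i : ι) {m : ℕ} (hm : 2 ≤ m) :
    m • P.root i ∉ range P.root := by
  haveI : Infinite k := IsAlgClosed.instInfinite
  have _i1 : Module.IsReflexive ℤ X := .of_isPerfPair P.toLinearMap
  have _i2 : IsAddTorsionFree X := .of_isTorsionFree ℤ X
  intro hmem
  -- the largest multiple of `α_i` which is a root
  set S : Set ℕ := {q : ℕ | (0 : X) + q • P.root i ∈ range P.root} with hS
  have hSfin : S.Finite := finite_setOf_add_nsmul_root_mem P 0 i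
  have hmS : m ∈ hSfin.toFinset := by
    rw [Set.Finite.mem_toFinset, hS, mem_setOf_eq, zero_add]; exact hmem
  have hne : hSfin.toFinset.Nonempty := ⟨m, hmS⟩
  have hqS : hSfin.toFinset.max' hne ∈ hSfin.toFinset := Finset.max'_mem _ _
  have hmax : ∀ q' ∈ hSfin.toFinset, q' ≤ hSfin.toFinset.max' hne := fun q' hq' => Finset.le_max' _ _ hq'
  generalize hq : hSfin.toFinset.max' hne = q at hqS hmax
  have hmq : m ≤ q := hmax m hmS
  rw [Set.Finite.mem_toFinset, hS, mem_setOf_eq, zero_add] at hqS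
  obtain ⟨l, hl⟩ := hqS
  have hq1 : (q + 1) • P.root i ∉ range P.root := by
    intro hcon
    have : q + 1 ∈ hSfin.toFinset := by
      rw [Set.Finite.mem_toFinset, hS, mem_setOf_eq, zero_add]; exact hcon
    have := hmax _ this
    omega
  -- `[e_i, e_l] = 0`: weight `(q + 1) α_i` is not a root and non-zero
  have hil : P.root i + P.root l = (q + 1) • P.root i := by rw [hl, add_smul, one_smul, add_comm]
  have hx0 : P.root i + P.root l ≠ 0 := by
    rw [hil]
    intro h0
    have : ((q + 1 : ℕ) : ℤ) • P.root i = 0 := by exact_mod_cast h0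
    rcases smul_eq_zero.mp this with h1 | h1
    · norm_cast at h1
    · exact P.ne_zero i h1
  have hx : P.root i + P.root l ∉ range P.root := by rw [hil]; exact hq1
  have hzero := h.lie_rootE_eq_zero_of_not_mem hG hT i (h.rootE_mem l) hx0 hx
  -- primitive vector of weight `2 q`
  have hprim := h.hasPrimitiveVectorWith_rootE i l hzero
  have hpair : ((P.pairing l i : ℤ) : k) = ((2 * q : ℕ) : k) := by
    rw [← P.root_coroot_eq_pairing, hl, map_nsmul, LinearMap.smul_apply, P.root_coroot_eq_pairing,
      P.pairing_same, nsmul_eq_mul]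
    push_cast; ring
  have hne := hprim.pow_toEnd_f_ne_zero_of_eq_nat hpair (i := q + 2) (by omega)
  -- but `(ad f)^{q-1} e_l ∈ 𝔤_{α_i}` and `(ad f)^3` kills `𝔤_{α_i}`
  apply hne
  obtain ⟨q', rfl⟩ : ∃ q', q = q' + 1 := ⟨q - 1, by omega⟩
  have hw := h.toEnd_rootF_pow_mem i (P.root l) (h.rootE_mem l) q'
  have e1 : P.root l - (q' : ℤ) • P.root i = P.root i := by
    rw [hl]; module
  rw [e1] at hw
  obtain ⟨c, hc⟩ := (h.mem_lieWeightSpace_root_iff hG hT i).1 hw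
  set f := LieModule.toEnd k (Matrix n n k) (Matrix n n k) (h.rootF i) with hf
  have hsplit : (f ^ (q' + 1 + 2)) (h.rootE l) = (f ^ 3) ((f ^ q') (h.rootE l)) := by
    rw [show q' + 1 + 2 = 3 + q' by omega, pow_add, Module.End.mul_apply]
  rw [hsplit, hc, map_smul]
  -- `(ad f)^3 e_i = 0`
  have h3 : (f ^ 3) (h.rootE i) = 0 := by
    have hfe : f (h.rootE i) = -h.rootH i := by
      rw [hf, toEnd_rootF_apply, ← h.lie_rootE_rootF i]; abel
    have hfh : f (h.rootH i) = (2 : k) • h.rootF i := by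
      rw [hf, toEnd_rootF_apply]
      have := h.lie_rootH_rootF i
      rw [← neg_sub, neg_inj] at this
      exact this
    have hff : f (h.rootF i) = 0 := by rw [hf, toEnd_rootF_apply, sub_self]
    have e3 : (f ^ 3) (h.rootE i) = f (f (f (h.rootE i))) := by
      simp [pow_succ, Module.End.mul_apply]
    rw [e3, hfe, map_neg, hfh, map_neg, map_smul, hff, smul_zero, neg_zero]
  rw [h3, smul_zero]

include hG hT h in
/-- `-(m α_i)` is not a root either, `m ≥ 2`. [folklore] -/
theorem IsRootDatumOf.neg_nsmul_root_notMem (i : ι) {m : ℕ} (hm : 2 ≤ m) :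
    -(m • P.root i) ∉ range P.root := by
  rw [P.neg_mem_range_root_iff]; exact h.nsmul_root_notMem hG hT i hm

include hG hT in
/-- **`[e_i, e_j] ≠ 0` whenever `α_i + α_j` is a root** (Humphreys 8.4 (d): `[𝔤_α, 𝔤_β] = 𝔤_{α+β}`
for roots `α, β, α + β`). If `[e_i, e_j] = 0` then `e_j` is primitive, so `p = ⟨α_j, α_i^∨⟩ ≥ 0`;
with `q ≥ 1` maximal such that `α_j + q α_i = α_l` is a root, `e_l` is primitive of weight
`p + 2q`, hence `[e_i, (ad f_i)^q e_l] = q (p + q + 1) (ad f_i)^{q-1} e_l ≠ 0`, while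
`(ad f_i)^q e_l ∈ 𝔤_{α_j} = k e_j` is killed by `ad e_i`. [cite: Humphreys1972, 8.4] -/
theorem IsRootDatumOf.lie_rootE_ne_zero_of_add_mem (i j : ι) (hij : P.root i + P.root j ∈ range P.root) :
    h.rootE i * h.rootE j - h.rootE j * h.rootE i ≠ 0 := by
  haveI : Infinite k := IsAlgClosed.instInfinite
  have _i1 : Module.IsReflexive ℤ X := .of_isPerfPair P.toLinearMap
  have _i2 : IsAddTorsionFree X := .of_isTorsionFree ℤ X
  intro h0
  -- `p = ⟨α_j, α_i^∨⟩ ∈ ℕ`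
  have hprim0 := h.hasPrimitiveVectorWith_rootE i j h0
  obtain ⟨p, hp⟩ := hprim0.exists_nat
  -- the top `q` of the `α_i`-string through `α_j`
  set S : Set ℕ := {q : ℕ | P.root j + q • P.root i ∈ range P.root} with hS
  have hSfin : S.Finite := finite_setOf_add_nsmul_root_mem P (P.root j) i
  have h1S : 1 ∈ hSfin.toFinset := by
    rw [Set.Finite.mem_toFinset, hS, mem_setOf_eq, one_smul, add_comm]; exact hij
  have hne : hSfin.toFinset.Nonempty := ⟨1, h1S⟩
  have hqS : hSfin.toFinset.max' hne ∈ hSfin.toFinset := Finset.max'_mem _ _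
  have hmax : ∀ q' ∈ hSfin.toFinset, q' ≤ hSfin.toFinset.max' hne := fun q' hq' => Finset.le_max' _ _ hq'
  generalize hq : hSfin.toFinset.max' hne = q at hqS hmax
  have h1q : 1 ≤ q := hmax 1 h1S
  rw [Set.Finite.mem_toFinset, hS, mem_setOf_eq] at hqS
  obtain ⟨l, hl⟩ := hqS
  have hq1 : P.root j + (q + 1) • P.root i ∉ range P.root := by
    intro hcon
    have : q + 1 ∈ hSfin.toFinset := by
      rw [Set.Finite.mem_toFinset, hS, mem_setOf_eq]; exact hcon
    have := hmax _ this
    omega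
  -- `[e_i, e_l] = 0`
  have hsum : P.root i + P.root l = P.root j + (q + 1) • P.root i := by
    rw [hl]; rw [add_smul, one_smul]; abel
  have hx0 : P.root i + P.root l ≠ 0 := by
    rw [hsum]
    intro hzero
    have hneg : P.root j = -((q + 1) • P.root i) := eq_neg_of_add_eq_zero_left hzero
    have : -((q + 1) • P.root i) ∈ range P.root := ⟨j, hneg⟩
    exact h.neg_nsmul_root_notMem hG hT i (by omega) this
  have hx : P.root i + P.root l ∉ range P.root := by rw [hsum]; exact hq1
  have hzero := h.lie_rootE_eq_zero_of_not_mem hG hT i (h.rootE_mem l) hx0 hx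
  have hprim := h.hasPrimitiveVectorWith_rootE i l hzero
  -- weight of `e_l` is `p + 2 q`
  have hpair : ((P.pairing l i : ℤ) : k) = ((p + 2 * q : ℕ) : k) := by
    rw [← P.root_coroot_eq_pairing, hl, map_add, map_nsmul, LinearMap.add_apply,
      LinearMap.smul_apply, P.root_coroot_eq_pairing, P.root_coroot_eq_pairing, P.pairing_same,
      nsmul_eq_mul, Int.cast_add, hp]
    push_cast; ring
  set f := LieModule.toEnd k (Matrix n n k) (Matrix n n k) (h.rootF i) with hf
  -- `w = (ad f)^{q-1} e_l ≠ 0` and `[e_i, (ad f)^q e_l] = q (p + q + 1) w`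
  obtain ⟨q', rfl⟩ : ∃ q', q = q' + 1 := ⟨q - 1, by omega⟩
  have hw_ne : (f ^ q') (h.rootE l) ≠ 0 :=
    hprim.pow_toEnd_f_ne_zero_of_eq_nat hpair (by omega)
  have hkey := hprim.lie_e_pow_succ_toEnd_f q'
  -- `(ad f)^{q'+1} e_l ∈ 𝔤_{α_j} = k e_j`, killed by `ad e_i`
  have hw := h.toEnd_rootF_pow_mem i (P.root l) (h.rootE_mem l) (q' + 1)
  have e1 : P.root l - ((q' + 1 : ℕ) : ℤ) • P.root i = P.root j := by
    rw [hl]; push_cast; module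
  rw [e1] at hw
  obtain ⟨c, hc⟩ := (h.mem_lieWeightSpace_root_iff hG hT j).1 hw
  have hlhs : ⁅h.rootE i, (f ^ (q' + 1)) (h.rootE l)⁆ = 0 := by
    change ⁅h.rootE i, (LieModule.toEnd k (Matrix n n k) (Matrix n n k) (h.rootF i) ^ (q' + 1)) (h.rootE l)⁆ = 0
    rw [← hf, hc, lie_smul, Ring.lie_def, h0, smul_zero]
  rw [hlhs] at hkey
  -- the scalar `(q'+1) (p + 2q - q') ≠ 0`
  have hscalar : ((q' + 1 : ℕ) : k) * (((p + 2 * (q' + 1) : ℕ) : k) - (q' : k)) ≠ 0 := by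
    have : ((q' + 1 : ℕ) : k) * (((p + 2 * (q' + 1) : ℕ) : k) - (q' : k)) = ((((q' + 1) * (p + q' + 2) : ℕ)) : k) := by
      push_cast; ring
    rw [this]
    exact_mod_cast (show (q' + 1) * (p + q' + 2) ≠ 0 by positivity)
  rw [hpair] at hkey
  have := hkey.symm
  rw [smul_eq_zero] at this
  rcases this with h1 | h1
  · exact hscalar (by exact_mod_cast h1)
  · exact hw_ne h1

include hG hT h in
/-- **`[A, B] ≠ 0` for non-zero `A ∈ 𝔤_{α_i}`, `B ∈ 𝔤_{α_j}` when `α_i + α_j` is a root.**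
[cite: Humphreys1972, 8.4] -/
theorem IsRootDatumOf.lie_ne_zero_of_mem_lieWeightSpace_root {i j : ι} (hij : P.root i + P.root j ∈ range P.root)
    {A B : Matrix n n k} (hA : A ∈ lieWeightSpace G T (charOfWeight eX (P.root i))) (hA0 : A ≠ 0)
    (hB : B ∈ lieWeightSpace G T (charOfWeight eX (P.root j))) (hB0 : B ≠ 0) :
    A * B - B * A ≠ 0 := by
  haveI : Infinite k := IsAlgClosed.instInfinite
  obtain ⟨a, rfl⟩ := (h.mem_lieWeightSpace_root_iff hG hT i).1 hA
  obtain ⟨b, rfl⟩ := (h.mem_lieWeightSpace_root_iff hG hT j).1 hB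
  have ha : a ≠ 0 := by rintro rfl; exact hA0 (zero_smul _ _)
  have hb : b ≠ 0 := by rintro rfl; exact hB0 (zero_smul _ _)
  rw [smul_mul_smul_comm, smul_mul_smul_comm, mul_comm b a, ← smul_sub]
  exact smul_ne_zero (mul_ne_zero ha hb) (h.lie_rootE_ne_zero_of_add_mem hG hT i j hij)

include hG hT in
/-- `[f_i, f_j] ≠ 0` when `α_i + α_j` is a root (apply the previous result to `-α_i, -α_j`).
[cite: Humphreys1972, 8.4] -/
theorem IsRootDatumOf.lie_rootF_ne_zero_of_add_mem (i j : ι) (hij : P.root i + P.root j ∈ range P.root) :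
    h.rootF i * h.rootF j - h.rootF j * h.rootF i ≠ 0 := by
  haveI : Infinite k := IsAlgClosed.instInfinite
  have hi : -P.root i = P.root (P.reflectionPerm i i) := by
    rw [RootPairing.root_reflectionPerm, RootPairing.reflection_apply_self]
  have hj : -P.root j = P.root (P.reflectionPerm j j) := by
    rw [RootPairing.root_reflectionPerm, RootPairing.reflection_apply_self]
  have hsum : P.root (P.reflectionPerm i i) + P.root (P.reflectionPerm j j) ∈ range P.root := by
    rw [← hi, ← hj, ← neg_add, P.neg_mem_range_root_iff]; exact hij
  have hA : h.rootF i ∈ lieWeightSpace G T (charOfWeight eX (P.root (P.reflectionPerm i i))) := by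
    rw [← hi]; exact h.rootF_mem' i
  have hB : h.rootF j ∈ lieWeightSpace G T (charOfWeight eX (P.root (P.reflectionPerm j j))) := by
    rw [← hj]; exact h.rootF_mem' j
  exact h.lie_ne_zero_of_mem_lieWeightSpace_root hG hT hsum hA (h.rootF_ne_zero i) hB (h.rootF_ne_zero j)

end Brackets

/-! ### Generation by the simple root vectors -/

section Generation

variable [IsAlgClosed k] [CharZero k] [Finite ι]
variable (hG : IsConnectedReductive G) (hT : IsMaximalTorusIn T G) (h : IsRootDatumOf G T P eX eY)

include hG hT in
/-- Positive roots: a bracket-closed subspace containing `e_i` for the simple roots `α_i` (with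
respect to a regular coweight `y`) contains `e_i` for all `y`-positive roots (induction on `⟨α, y⟩`).
[cite: Humphreys1972, 14.2] -/
theorem IsRootDatumOf.rootE_mem_of_forall_simpleRoots_of_pos {y : Y}
    {L : Submodule k (Matrix n n k)} (hL : ∀ A ∈ L, ∀ B ∈ L, A * B - B * A ∈ L)
    (hE : ∀ i ∈ simpleRoots P y, h.rootE i ∈ L) {i : ι} (hi : 0 < P.root' i y) : h.rootE i ∈ L := by
  haveI : Infinite k := IsAlgClosed.instInfinite
  refine pos_root_induction (p := fun i => h.rootE i ∈ L) hE (fun i j l hijl _ _ hj hl => ?_) hi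
  -- `α_i = α_j + α_l`: `[e_j, e_l]` is a non-zero element of `𝔤_{α_i} ∩ L`
  have hmem : h.rootE j * h.rootE l - h.rootE l * h.rootE j ∈
      lieWeightSpace G T (charOfWeight eX (P.root i)) := by
    rw [hijl]; exact lie_mem_lieWeightSpace_charOfWeight eX (h.rootE_mem j) (h.rootE_mem l)
  have hne : h.rootE j * h.rootE l - h.rootE l * h.rootE j ≠ 0 :=
    h.lie_rootE_ne_zero_of_add_mem hG hT j l (by rw [← hijl]; exact mem_range_self i)
  obtain ⟨c, hc⟩ := (h.mem_lieWeightSpace_root_iff hG hT i).1 hmem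
  have hc0 : c ≠ 0 := by rintro rfl; exact hne (by rw [hc, zero_smul])
  have hcL : c • h.rootE i ∈ L := hc ▸ hL _ hj _ hl
  have := L.smul_mem c⁻¹ hcL
  rwa [smul_smul, inv_mul_cancel₀ hc0, one_smul] at this

omit [Finite ι] in
include hG hT in
/-- `e_{-i}` (for the index `-i = s_i i` of `-α_i`) is a non-zero multiple of `f_i`; so a subspace
contains `e_{-i}` iff it contains `f_i`. [folklore] -/
theorem IsRootDatumOf.rootE_reflectionPerm_mem_iff (i : ι) (L : Submodule k (Matrix n n k)) :
    h.rootE (P.reflectionPerm i i) ∈ L ↔ h.rootF i ∈ L := by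
  haveI : Infinite k := IsAlgClosed.instInfinite
  have hi : -P.root i = P.root (P.reflectionPerm i i) := by
    rw [RootPairing.root_reflectionPerm, RootPairing.reflection_apply_self]
  have hF : h.rootF i ∈ lieWeightSpace G T (charOfWeight eX (P.root (P.reflectionPerm i i))) := by
    rw [← hi]; exact h.rootF_mem' i
  obtain ⟨c, hc⟩ := (h.mem_lieWeightSpace_root_iff hG hT (P.reflectionPerm i i)).1 hF
  have hc0 : c ≠ 0 := by rintro rfl; exact h.rootF_ne_zero i (by rw [hc, zero_smul])
  constructor
  · intro hm; rw [hc]; exact L.smul_mem c hm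
  · intro hm
    have := L.smul_mem c⁻¹ hm
    rwa [hc, smul_smul, inv_mul_cancel₀ hc0, one_smul] at this

include hG hT in
/-- **Generation by the simple root vectors** (Humphreys 14.2, Proposition): a bracket-closed
subspace `L ⊆ 𝔤𝔩ₙ` containing `e_i` and `f_i` for all simple roots `α_i` (relative to a regular
coweight `y`) contains `e_i` for every root `α_i`. [cite: Humphreys1972, 14.2] -/
theorem IsRootDatumOf.rootE_mem_of_forall_simpleRoots {y : Y} (hy : ∀ i, P.root' i y ≠ 0)
    {L : Submodule k (Matrix n n k)} (hL : ∀ A ∈ L, ∀ B ∈ L, A * B - B * A ∈ L)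
    (hE : ∀ i ∈ simpleRoots P y, h.rootE i ∈ L) (hF : ∀ i ∈ simpleRoots P y, h.rootF i ∈ L) (i : ι) :
    h.rootE i ∈ L := by
  rcases lt_or_gt_of_ne (hy i) with hneg | hpos
  · -- `α_i` is `(-y)`-positive; the simple roots for `-y` are the `-α_j`, `α_j` simple for `y`
    letI := P.indexNeg
    have hpos' : 0 < P.root' i (-y) := by rw [map_neg]; exact neg_pos.mpr hneg
    refine h.rootE_mem_of_forall_simpleRoots_of_pos hG hT hL (fun j hj => ?_) hpos'
    have hj' : -j ∈ simpleRoots P y := mem_simpleRoots_neg_iff.mp hj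
    have : j = P.reflectionPerm (-j) (-j) := by
      change j = -(-j); exact (neg_neg j).symm
    rw [this, h.rootE_reflectionPerm_mem_iff hG hT]
    exact hF _ hj'
  · exact h.rootE_mem_of_forall_simpleRoots_of_pos hG hT hL hE hpos

include hG hT in
/-- … and `f_i`, `h_i` for every root `α_i`. [cite: Humphreys1972, 14.2] -/
theorem IsRootDatumOf.rootF_rootH_mem_of_forall_simpleRoots {y : Y} (hy : ∀ i, P.root' i y ≠ 0)
    {L : Submodule k (Matrix n n k)} (hL : ∀ A ∈ L, ∀ B ∈ L, A * B - B * A ∈ L)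
    (hE : ∀ i ∈ simpleRoots P y, h.rootE i ∈ L) (hF : ∀ i ∈ simpleRoots P y, h.rootF i ∈ L) (i : ι) :
    h.rootF i ∈ L ∧ h.rootH i ∈ L := by
  haveI : Infinite k := IsAlgClosed.instInfinite
  have hf : h.rootF i ∈ L := by
    rw [← h.rootE_reflectionPerm_mem_iff hG hT]
    exact h.rootE_mem_of_forall_simpleRoots hG hT hy hL hE hF _
  refine ⟨hf, ?_⟩
  rw [← h.lie_rootE_rootF i]
  exact hL _ (h.rootE_mem_of_forall_simpleRoots hG hT hy hL hE hF i) _ hf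

end Generation

end Literature.NumberTheory.Automorphic
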